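import Summits.BirchSwinnertonDyer.BirchSwinnertonDyer.Theorems.ThetaPartnerAtTwoSignedKatoUpToAtTwoLocalTwoTower
import HarnessLib

/-!
# Route `ThetaPartnerAtTwo` (TP2), crux K3 `SignedKatoDivisibilityUpToAtTwo` (item stmt-BirchSwinnertonDyer-20308),
# line `colemanrat` v3 — THE LOCAL THEORY AT `p = 2`, file 9: the `Δ`-TRACE of Kobayashi's tower points and the
# trace relations of the `ℤ₂`-tower `ℚ_{2,n} = ℚ₂(ζ_{2^{n+2}})⁺` (deviations (d2)/(d3) of the port memo
# G2-PORT-AT-2.md §2, at the level of logarithms and of points)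

HONEST FRAMING (cell `bsd-wall`, lead `bsd-wall-tp2-p2x` g2): THEOREMS ONLY — no definition, no named fact, no
instance, no `sorry`; local formal-group theory; nothing about any Selmer group is asserted; closes no item; BSD is
NOT proved by any of this.

## Why this file

At `p = 2` the `n`-th layer `ℚ_{2,n}` of the cyclotomic `ℤ₂`-extension of `ℚ₂` is NOT a field `ℚ₂(ζ_{2^m})` of the
μ-tower but the fixed field of `⟨Stab ζ_{2^{n+2}}, σ⟩`, `σ` an automorphism inverting `ζ_{2^{n+2}}` (complex
conjugation). Kobayashi's `±` points on the `ℤ₂`-tower are therefore the Δ-traces `e_n = c_{n+2} + σ·c_{n+2}` of the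
μ-tower points (files 2, 5). This file proves that such Δ-traces again satisfy trace relations of Kobayashi's
Lemma 8.9 shape down the tower: at the level of logarithms,
`∑_{q ∈ Stab ζ_{p^m}/Stab ζ_{p^{m+1}}} q̃•(ℓ_{m+1} + σ•ℓ_{m+1}) = −2p − (ℓ_{m−1} + σ•ℓ_{m−1})` for EVERY `σ ∈ Gal(ℚ̄_p/ℚ_p)`
and every prime (the Galois group of `ℚ_p(ζ_{p^∞})/ℚ_p` is abelian, so traces commute with `σ`), and at the level of
points: `(∑_q act q̃ c_{m+1}) + (∑_q act q̃ (act σ c_{m+1})) + (c_{m−1} + act σ c_{m−1}) ∈ E(ℚ_p)` (logarithm `−2p`). At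
`p = 2` with `σ ζ_{2^{m+1}} = ζ_{2^{m+1}}⁻¹` (such `σ` exist: `exists_smul_zeta_eq_inv`) these are the trace relations
`Tr_{n/n−1} e_n + e_{n−2} ∈ E(ℚ₂)` of the `ℤ₂`-tower points `e_n`, `n = m − 1` (with the tree's uncorrected points
`ℓ_1 + σ•ℓ_1 = 2(ζ_2 − 1) = −4`, so `Tr_{1/0} e_1 ∈ E(ℚ₂)` has logarithm `0`: (d3) in the normalisation of file 2).

## What is proved (`Ω = ℚ̄_p`, `ℓ_m = ell p m`, `ζ_m = zeta p m`; ANY prime unless stated)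

* §1 `smul_zeta_comm`, `smul_smul_comm_of_mem_layer`: the actions of two elements of `Gal(ℚ̄_p/ℚ_p)` commute on
  `ℚ_p(ζ_{p^m})`; `exists_smul_zeta_eq_inv`: an automorphism inverting `ζ_{p^m}` (`m ≥ 1`).
* §2 `sum_smul_add_smul_ell_succ`: the Δ-twisted trace identity above (`m ≥ 1`), every prime;
  `ell_one_add_smul_ell_one_two` (`p = 2`: `ℓ_1 + σ•ℓ_1 = −4`).
* §3 `sum_act_add_sum_act_add_mem`: the point-level relation for any family of tower points with `Λ = ℓ` (no
  `p`-power torsion on `L(m+1)` assumed), every prime; `…_two`: at `p = 2` on a good supersingular model with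
  `2 ∣ a₁`, unconditionally (file 5).

References: [Kobayashi2003] Lemma 8.9, §8.4; [KuriharaOtsuki2006] §1.3, Prop. 1.4; [KitajimaOtsuki2018] Prop. 3.4.
-/

set_option autoImplicit false
-- the Theorems namespace of this sub repeats the summit name by design (D-0017 nested layout)
set_option linter.dupNamespace false

noncomputable section

open scoped Classical Topology NNReal
open Filter PowerSeries Finset Polynomial

namespace Summit.BirchSwinnertonDyer.BirchSwinnertonDyer.Theorems

namespace SignedKatoOffTwo.LocalTwo

open Literature.RingTheory.FormalGroups WeierstrassCurve Field
open Summit.BirchSwinnertonDyer.Rank1Residual.Additive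
open Summit.BirchSwinnertonDyer.Rank1Residual.Additive.PadicCyclotomicTower
open Summit.BirchSwinnertonDyer.Rank1Residual.Additive.BallEval
open Summit.BirchSwinnertonDyer.BirchSwinnertonDyer.Theorems.SignedKatoOffTwo.LocalAllPrimes
open Literature.NumberTheory.EllipticCurves Literature.NumberTheory.EllipticCurves.FormalGroupChart
open Literature.NumberTheory.GaloisRepresentations

/-! ## §1 Commuting Galois actions on the cyclotomic layers; an automorphism inverting `ζ` -/

section Galois

variable (p : ℕ) [hp : Fact p.Prime]

/-- Two elements of `Gal(ℚ̄_p/ℚ_p)` commute on `ζ_{p^m}` (both act by powers). [folklore] -/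
theorem smul_zeta_comm (σ τ : Field.absoluteGaloisGroup ℚ_[p]) (m : ℕ) :
    σ • (τ • zeta p m) = τ • (σ • zeta p m) := by
  obtain ⟨a, -, ha⟩ := exists_apply_zeta_eq_pow p (Field.absoluteGaloisGroup.toAlgEquiv ℚ_[p] σ) m
  obtain ⟨b, -, hb⟩ := exists_apply_zeta_eq_pow p (Field.absoluteGaloisGroup.toAlgEquiv ℚ_[p] τ) m
  simp only [Field.absoluteGaloisGroup.smul_def, map_pow, ha, hb, ← pow_mul, mul_comm a b]

/-- **The actions of two elements of `Gal(ℚ̄_p/ℚ_p)` commute on `ℚ_p(ζ_{p^m})`** (`Gal(ℚ_p(ζ_{p^m})/ℚ_p)` is abelian: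
an element of the layer is a polynomial in `ζ_{p^m}`). [cite: NeukirchANT1999, Ch. IV §1] -/
theorem smul_smul_comm_of_mem_layer (σ τ : Field.absoluteGaloisGroup ℚ_[p]) {m : ℕ} {y : PadicAlgCl p}
    (hy : y ∈ layer p m) : σ • (τ • y) = τ • (σ • y) := by
  obtain ⟨r, -, rfl⟩ := exists_aeval_zeta_eq p hy
  have h := smul_zeta_comm p σ τ m
  simp only [Field.absoluteGaloisGroup.smul_def] at h ⊢
  have h2 : ∀ (f : PadicAlgCl p ≃ₐ[ℚ_[p]] PadicAlgCl p) (x : PadicAlgCl p), f (aeval x r) = aeval (f x) r :=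
    fun f x => by simpa using (Polynomial.aeval_algHom_apply (f : PadicAlgCl p →ₐ[ℚ_[p]] PadicAlgCl p) x r).symm
  simp only [h2, h]

/-- **An automorphism inverting `ζ_{p^m}`** (`m ≥ 1`): `ζ^{p^m − 1} = ζ⁻¹` is a Galois conjugate of `ζ` (the tree's Galois
supply `exists_algEquiv_apply_zeta_eq_pow`). At `p = 2` its restriction generates `Gal(ℚ₂(ζ_{2^m})/ℚ₂(ζ_{2^m})⁺)`.
[cite: Tate1967, §3.1] -/
theorem exists_smul_zeta_eq_inv {m : ℕ} (hm : 1 ≤ m) :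
    ∃ σ : Field.absoluteGaloisGroup ℚ_[p], σ • zeta p m = (zeta p m)⁻¹ := by
  have h1 : 1 ≤ p ^ m := Nat.one_le_pow _ _ hp.out.pos
  have hcop : (p ^ m - 1).Coprime p := by
    refine ((Nat.Prime.coprime_iff_not_dvd hp.out).mpr fun h => ?_).symm
    have hdvd : p ∣ p ^ m - (p ^ m - 1) := Nat.dvd_sub (dvd_pow_self p (by omega : m ≠ 0)) h
    rw [Nat.sub_sub_self h1] at hdvd
    exact hp.out.one_lt.ne' (Nat.dvd_one.mp hdvd)
  obtain ⟨σ', hσ'⟩ := exists_algEquiv_apply_zeta_eq_pow p hm hcop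
  refine ⟨(Field.absoluteGaloisGroup.toAlgEquiv ℚ_[p]).symm σ', ?_⟩
  rw [Field.absoluteGaloisGroup.toAlgEquiv_symm_apply, hσ']
  have hζ : zeta p m ^ (p ^ m - 1) * zeta p m = 1 := by
    rw [pow_sub_one_mul (by positivity), (isPrimitiveRoot_zeta p m).pow_eq_one]
  exact eq_inv_of_mul_eq_one_left hζ

end Galois

/-! ## §2 The `Δ`-twisted trace identity for `ℓ` -/

section Ell

variable (p : ℕ) [hp : Fact p.Prime]

/-- `ℓ_m ∈ ℚ_p(ζ_{p^m})` (each term `(ζ_{p^{m−2k}} − 1)/pᵏ` lies in `layer (m − 2k) ≤ layer m`). [folklore] -/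
theorem ell_mem_layer (m : ℕ) : ell p m ∈ layer p m := by
  rw [ell]
  refine Subalgebra.sum_mem _ fun k _ => ?_
  have hz : zeta p (m - 2 * k) ∈ layer p m := layer_mono p (Nat.sub_le m (2 * k)) (zeta_mem_layer p (m - 2 * k))
  refine IntermediateField.div_mem _ ?_ ?_
  · exact Subalgebra.mul_mem _ (Subalgebra.pow_mem _ (Subalgebra.neg_mem _ (Subalgebra.one_mem _)) _)
      (IntermediateField.sub_mem _ hz (IntermediateField.one_mem _))
  · exact Subalgebra.pow_mem _ (by exact_mod_cast IntermediateField.natCast_mem (layer p m) p) _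

/-- An element of `Gal(ℚ̄_p/ℚ_p)` fixes the rational integer `p`. [folklore] -/
theorem smul_natCast (σ : Field.absoluteGaloisGroup ℚ_[p]) (n : ℕ) : σ • (n : PadicAlgCl p) = n := by
  rw [Field.absoluteGaloisGroup.smul_def, map_natCast]

/-- **The `Δ`-twisted trace identity, every prime**: for `m ≥ 1` and ANY `σ ∈ Gal(ℚ̄_p/ℚ_p)`,
`∑_{q ∈ Stab ζ_{p^m} / Stab ζ_{p^{m+1}}} q̃ • (ℓ_{m+1} + σ•ℓ_{m+1}) = −2p − (ℓ_{m−1} + σ•ℓ_{m−1})` — the trace identity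
`∑ q̃•ℓ_{m+1} = −p − ℓ_{m−1}` (file `KobayashiTowerPoints`) applied to `ℓ` and to `σ•ℓ`, using that `q̃` and `σ` commute on
the layer (§1). At `p = 2` with `σ ζ = ζ⁻¹` this is the trace relation of the logarithms `ℓ_{m+1} + σ•ℓ_{m+1}` of the
`ℤ₂`-tower points `e_{m−1} = c_{m+1} + σ c_{m+1}` down `ℚ_{2,m−1}/ℚ_{2,m−2}`. [cite: Kobayashi2003, Lemma 8.9]
[cite: KuriharaOtsuki2006, Prop. 1.4] -/
theorem sum_smul_add_smul_ell_succ {m : ℕ} (hm : 1 ≤ m) (σ : Field.absoluteGaloisGroup ℚ_[p])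
    [Fintype (stab p m ⧸ (stab p (m + 1)).subgroupOf (stab p m))] :
    ∑ q : stab p m ⧸ (stab p (m + 1)).subgroupOf (stab p m),
        ((q.out : stab p m) : Field.absoluteGaloisGroup ℚ_[p]) • (ell p (m + 1) + σ • ell p (m + 1)) =
      -(2 * (p : PadicAlgCl p)) - (ell p (m - 1) + σ • ell p (m - 1)) := by
  have hℓ : ell p (m + 1) ∈ layer p (m + 1) := ell_mem_layer p (m + 1)
  simp_rw [smul_add]
  rw [sum_add_distrib, sum_smul_ell_succ hm]
  have hσ : ∑ q : stab p m ⧸ (stab p (m + 1)).subgroupOf (stab p m),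
      ((q.out : stab p m) : Field.absoluteGaloisGroup ℚ_[p]) • (σ • ell p (m + 1)) =
        σ • ∑ q : stab p m ⧸ (stab p (m + 1)).subgroupOf (stab p m),
          ((q.out : stab p m) : Field.absoluteGaloisGroup ℚ_[p]) • ell p (m + 1) := by
    rw [smul_sum]
    exact sum_congr rfl fun q _ => smul_smul_comm_of_mem_layer p _ σ hℓ
  rw [hσ, sum_smul_ell_succ hm, smul_sub, smul_neg, smul_natCast]
  ring

/-- At `p = 2`: `ℓ_1 + σ•ℓ_1 = −4` (`ℓ_1 = ζ_2 − 1 = −2` is rational), so the `m = 1` case of the twisted identity reads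
`∑ q̃•(ℓ_2 + σ•ℓ_2) = −4 − (ℓ_0 + σ•ℓ_0) = −4` and the `m = 2` case `∑ q̃•(ℓ_3 + σ•ℓ_3) = −4 − (ℓ_1 + σ•ℓ_1) = 0` — with the
tree's (uncorrected) points the first `ℤ₂`-tower point `e_1 = c_3 + σc_3` has trace of logarithm `0` to `ℚ₂`
(deviation (d3) of the port memo, in the normalisation of file 2). [cite: KuriharaOtsuki2006, §1.3] -/
theorem ell_one_add_smul_ell_one_two (σ : Field.absoluteGaloisGroup ℚ_[2]) :
    ell 2 1 + σ • ell 2 1 = -4 := by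
  have h1 : ell 2 1 = -2 := by
    rw [ell, sum_range_one, pow_zero, one_mul, mul_zero, Nat.sub_zero, pow_zero, div_one]
    have hz : zeta 2 1 = -1 := by
      have h := isPrimitiveRoot_zeta 2 1
      rw [pow_one] at h
      exact h.eq_neg_one_of_two_right
    rw [hz]; norm_num
  rw [h1, show (-2 : PadicAlgCl 2) = -((2 : ℕ) : PadicAlgCl 2) by norm_num, smul_neg, smul_natCast]
  norm_num

end Ell

/-! ## §3 The point-level `Δ`-twisted trace relation -/

section Points

variable (p : ℕ) [hp : Fact p.Prime] (M : WeierstrassCurve ℤ_[p])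
  [hE : (M.map PadicInt.Coe.ringHom).IsElliptic]
  [hintΩ : (genFibΩ p M).IsIntegral (Valued.v (R := PadicAlgCl p)).integer]

variable {p M}

/-- **The `Δ`-twisted trace relation for tower points, every prime**: for `m ≥ 1`, ANY `σ ∈ Gal(ℚ̄_p/ℚ_p)`, tower points
`c ∈ L(m+1) ∩ E₁`, `c' ∈ L(m−1) ∩ E₁` with `Λ(c) = ℓ_{m+1}`, `Λ(c') = ℓ_{m−1}`, and no `p`-power torsion on `L(m+1)`:
`(∑_q act q̃ c) + (∑_q act q̃ (act σ c)) + (c' + act σ c') ∈ L(0) = E(ℚ_p)` (its logarithm is `−2p`, §2). At `p = 2` with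
`σ ζ_{2^{m+1}} = ζ_{2^{m+1}}⁻¹`: the trace relation `Tr_{ℚ_{2,m−1}/ℚ_{2,m−2}} e_{m−1} + e_{m−3} ∈ E(ℚ₂)` of the `ℤ₂`-tower points
`e = c + σc` (the sum over `Stab ζ_{2^m}/Stab ζ_{2^{m+1}}` realises the trace of the quadratic layer step).
[cite: Kobayashi2003, Lemma 8.9] [cite: KuriharaOtsuki2006, Prop. 1.4] -/
theorem sum_act_add_sum_act_add_mem
    (act : Field.absoluteGaloisGroup ℚ_[p] → (genFibΩ p M).toAffine.Point → (genFibΩ p M).toAffine.Point)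
    (hact0 : ∀ σ, act σ 0 = 0)
    (hact : ∀ σ (x y : PadicAlgCl p) (h : (genFibΩ p M).toAffine.Nonsingular x y),
      ∃ h', act σ (Affine.Point.some x y h) = Affine.Point.some (σ • x) (σ • y) h')
    (σ : Field.absoluteGaloisGroup ℚ_[p]) {m : ℕ} (hm : 1 ≤ m)
    [Fintype (stab p m ⧸ (stab p (m + 1)).subgroupOf (stab p m))]
    (htors : ∀ Q ∈ subfieldPoints (genFibΩ p M) (layer p (m + 1)).toSubfield coeffs_mem_layer, ∀ k : ℕ, p ^ k • Q = 0 → Q = 0)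
    {c c' : (genFibΩ p M).toAffine.Point}
    (hcL : c ∈ subfieldPoints (genFibΩ p M) (layer p (m + 1)).toSubfield coeffs_mem_layer)
    (hck : c ∈ kernel (Valued.v (R := PadicAlgCl p)) (genFibΩ p M)) (hcℓ : ptLogΩ p M c = ell p (m + 1))
    (hc'L : c' ∈ subfieldPoints (genFibΩ p M) (layer p (m - 1)).toSubfield coeffs_mem_layer)
    (hc'k : c' ∈ kernel (Valued.v (R := PadicAlgCl p)) (genFibΩ p M)) (hc'ℓ : ptLogΩ p M c' = ell p (m - 1)) :
    (∑ q : stab p m ⧸ (stab p (m + 1)).subgroupOf (stab p m), act ((q.out : stab p m) : Field.absoluteGaloisGroup ℚ_[p]) c) +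
      (∑ q : stab p m ⧸ (stab p (m + 1)).subgroupOf (stab p m),
        act ((q.out : stab p m) : Field.absoluteGaloisGroup ℚ_[p]) (act σ c)) +
      (c' + act σ c') ∈ subfieldPoints (genFibΩ p M) (layer p 0).toSubfield coeffs_mem_layer := by
  haveI := isIntegral_curveK p (LayerField p (m + 1)) M
  have hzlt : ∀ {Q : (genFibΩ p M).toAffine.Point}, Q ∈ kernel (Valued.v (R := PadicAlgCl p)) (genFibΩ p M) →
      ‖Q.zCoord‖ < 1 := fun hQ => by
    have := val_zCoord_lt_one hQ
    rwa [PadicAlgCl.valuation_def, ← NNReal.coe_lt_coe, coe_nnnorm, NNReal.coe_one] at this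
  -- the conjugate points `act σ c`, `act σ c'`
  have hσcL : act σ c ∈ subfieldPoints (genFibΩ p M) (layer p (m + 1)).toSubfield coeffs_mem_layer :=
    act_mem_subfieldPoints act hact0 hact σ hcL
  have hσck : act σ c ∈ kernel (Valued.v (R := PadicAlgCl p)) (genFibΩ p M) := act_mem_kernel act hact0 hact σ hck
  have hσc'L : act σ c' ∈ subfieldPoints (genFibΩ p M) (layer p (m + 1)).toSubfield coeffs_mem_layer :=
    act_mem_subfieldPoints act hact0 hact σ (subfieldPoints_layer_mono (by omega) hc'L)
  have hσc'k : act σ c' ∈ kernel (Valued.v (R := PadicAlgCl p)) (genFibΩ p M) := act_mem_kernel act hact0 hact σ hc'k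
  have hc'L' : c' ∈ subfieldPoints (genFibΩ p M) (layer p (m + 1)).toSubfield coeffs_mem_layer :=
    subfieldPoints_layer_mono (by omega) hc'L
  -- the two trace sums
  have hS1L : (∑ q : stab p m ⧸ (stab p (m + 1)).subgroupOf (stab p m),
      act ((q.out : stab p m) : Field.absoluteGaloisGroup ℚ_[p]) c) ∈
        subfieldPoints (genFibΩ p M) (layer p (m + 1)).toSubfield coeffs_mem_layer :=
    (subfieldPoints _ _ _).sum_mem fun q _ => act_mem_subfieldPoints act hact0 hact _ hcL
  have hS1k : (∑ q : stab p m ⧸ (stab p (m + 1)).subgroupOf (stab p m),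
      act ((q.out : stab p m) : Field.absoluteGaloisGroup ℚ_[p]) c) ∈ kernel (Valued.v (R := PadicAlgCl p)) (genFibΩ p M) :=
    (kernel (Valued.v (R := PadicAlgCl p)) (genFibΩ p M)).sum_mem fun q _ => act_mem_kernel act hact0 hact _ hck
  have hS2L : (∑ q : stab p m ⧸ (stab p (m + 1)).subgroupOf (stab p m),
      act ((q.out : stab p m) : Field.absoluteGaloisGroup ℚ_[p]) (act σ c)) ∈
        subfieldPoints (genFibΩ p M) (layer p (m + 1)).toSubfield coeffs_mem_layer :=
    (subfieldPoints _ _ _).sum_mem fun q _ => act_mem_subfieldPoints act hact0 hact _ hσcL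
  have hS2k : (∑ q : stab p m ⧸ (stab p (m + 1)).subgroupOf (stab p m),
      act ((q.out : stab p m) : Field.absoluteGaloisGroup ℚ_[p]) (act σ c)) ∈ kernel (Valued.v (R := PadicAlgCl p)) (genFibΩ p M) :=
    (kernel (Valued.v (R := PadicAlgCl p)) (genFibΩ p M)).sum_mem fun q _ => act_mem_kernel act hact0 hact _ hσck
  have hDL : c' + act σ c' ∈ subfieldPoints (genFibΩ p M) (layer p (m + 1)).toSubfield coeffs_mem_layer :=
    (subfieldPoints _ _ _).add_mem hc'L' hσc'L
  have hDk : c' + act σ c' ∈ kernel (Valued.v (R := PadicAlgCl p)) (genFibΩ p M) :=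
    (kernel (Valued.v (R := PadicAlgCl p)) (genFibΩ p M)).add_mem hc'k hσc'k
  refine mem_subfieldPoints_of_ptLogΩ_mem act hact0 hact htors
    ((subfieldPoints _ _ _).add_mem ((subfieldPoints _ _ _).add_mem hS1L hS2L) hDL)
    ((kernel (Valued.v (R := PadicAlgCl p)) (genFibΩ p M)).add_mem
      ((kernel (Valued.v (R := PadicAlgCl p)) (genFibΩ p M)).add_mem hS1k hS2k) hDk) ?_
  -- the logarithm: `∑ q̃•ℓ + ∑ q̃•σ•ℓ + (ℓ' + σ•ℓ') = −2p`
  rw [ptLogΩ_add (m := m + 1) ((subfieldPoints _ _ _).add_mem hS1L hS2L) hDL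
      ((kernel (Valued.v (R := PadicAlgCl p)) (genFibΩ p M)).add_mem hS1k hS2k) hDk,
    ptLogΩ_add (m := m + 1) hS1L hS2L hS1k hS2k,
    ptLogΩ_add (m := m + 1) hc'L' hσc'L hc'k hσc'k,
    ptLogΩ_finset_sum (m := m + 1) _ _ (fun q _ => act_mem_subfieldPoints act hact0 hact _ hcL)
      (fun q _ => act_mem_kernel act hact0 hact _ hck),
    ptLogΩ_finset_sum (m := m + 1) _ _ (fun q _ => act_mem_subfieldPoints act hact0 hact _ hσcL)
      (fun q _ => act_mem_kernel act hact0 hact _ hσck)]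
  simp_rw [ptLogΩ_act act hact0 hact _ (hzlt hck), ptLogΩ_act act hact0 hact _ (hzlt hσck),
    ptLogΩ_act act hact0 hact σ (hzlt hck), ptLogΩ_act act hact0 hact σ (hzlt hc'k), hcℓ, hc'ℓ]
  rw [← sum_add_distrib]
  simp_rw [← smul_add]
  rw [sum_smul_add_smul_ell_succ p hm σ]
  have e : -(2 * (p : PadicAlgCl p)) - (ell p (m - 1) + σ • ell p (m - 1)) + (ell p (m - 1) + σ • ell p (m - 1)) =
      -(2 * (p : PadicAlgCl p)) := by ring
  rw [e]
  refine IntermediateField.neg_mem _ (Subalgebra.mul_mem _ ?_ ?_)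
  · exact_mod_cast IntermediateField.natCast_mem (layer p 0) 2
  · exact_mod_cast IntermediateField.natCast_mem (layer p 0) p

/-- **The `ℤ₂`-tower trace relation at `p = 2`, unconditionally**: as above on a good supersingular `ℤ₂`-model
(`2 ∣ a₁`), the torsion hypothesis being Prop. 8.7 at `2` (file 5). [cite: Kobayashi2003, Lemma 8.9] [cite: KuriharaOtsuki2006, Prop. 1.4] -/
theorem sum_act_add_sum_act_add_mem_two {M : WeierstrassCurve ℤ_[2]}
    [(M.map PadicInt.Coe.ringHom).IsElliptic] [(M.map PadicInt.toZMod).IsElliptic]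
    [(genFibΩ 2 M).IsIntegral (Valued.v (R := PadicAlgCl 2)).integer]
    (h₁ : M.a₁ ∈ IsLocalRing.maximalIdeal ℤ_[2])
    (act : Field.absoluteGaloisGroup ℚ_[2] → (genFibΩ 2 M).toAffine.Point → (genFibΩ 2 M).toAffine.Point)
    (hact0 : ∀ σ, act σ 0 = 0)
    (hact : ∀ σ (x y : PadicAlgCl 2) (h : (genFibΩ 2 M).toAffine.Nonsingular x y),
      ∃ h', act σ (Affine.Point.some x y h) = Affine.Point.some (σ • x) (σ • y) h')
    (σ : Field.absoluteGaloisGroup ℚ_[2]) {m : ℕ} (hm : 1 ≤ m)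
    [Fintype (stab 2 m ⧸ (stab 2 (m + 1)).subgroupOf (stab 2 m))]
    {c c' : (genFibΩ 2 M).toAffine.Point}
    (hcL : c ∈ subfieldPoints (genFibΩ 2 M) (layer 2 (m + 1)).toSubfield coeffs_mem_layer)
    (hck : c ∈ kernel (Valued.v (R := PadicAlgCl 2)) (genFibΩ 2 M)) (hcℓ : ptLogΩ 2 M c = ell 2 (m + 1))
    (hc'L : c' ∈ subfieldPoints (genFibΩ 2 M) (layer 2 (m - 1)).toSubfield coeffs_mem_layer)
    (hc'k : c' ∈ kernel (Valued.v (R := PadicAlgCl 2)) (genFibΩ 2 M)) (hc'ℓ : ptLogΩ 2 M c' = ell 2 (m - 1)) :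
    (∑ q : stab 2 m ⧸ (stab 2 (m + 1)).subgroupOf (stab 2 m), act ((q.out : stab 2 m) : Field.absoluteGaloisGroup ℚ_[2]) c) +
      (∑ q : stab 2 m ⧸ (stab 2 (m + 1)).subgroupOf (stab 2 m),
        act ((q.out : stab 2 m) : Field.absoluteGaloisGroup ℚ_[2]) (act σ c)) +
      (c' + act σ c') ∈ subfieldPoints (genFibΩ 2 M) (layer 2 0).toSubfield coeffs_mem_layer :=
  sum_act_add_sum_act_add_mem act hact0 hact σ hm
    (fun _ hQ _ hk ↦ eq_zero_of_two_pow_smul_eq_zero_of_mem_subfieldPoints_layer M h₁ (m + 1) hQ hk)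
    hcL hck hcℓ hc'L hc'k hc'ℓ

end Points

end SignedKatoOffTwo.LocalTwo

end Summit.BirchSwinnertonDyer.BirchSwinnertonDyer.Theorems

end
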